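import Literature.Probability.RandomPlanarGeometry.HexSAWTriangle
import Summits.CriticalPhenomena.SAWScalingLimit.Theorems.SAWDevelopingMapHexConjectureArcsInWindow
import HarnessLib

/-!
# Crux `HexConjecture` (stmt-CriticalPhenomena-0808), line `root-locality-replaces-loewner`:
the coded floor-arch sums of the Duminil-Copin–Smirnov trapezoid are even in the offset

Landing target:
`Summits/CriticalPhenomena/SAWScalingLimit/Theorems/SAWDevelopingMapHexConjectureCodedReflect.lean`
(`--supports stmt-CriticalPhenomena-0808`).

The "coded floor-arch sum at offset `d`" of the trapezoid `S_{N+1,N+1}` (`HV.stripV (N+1) (N+1)`,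
`HexSAWStrip.lean`) is the `x_c`-mass `Σ x_c^{ℓ(P)}` of the self-avoiding mid-edge walks
`P ∈ midWalks (stripV (N+1) (N+1))` from `a` whose final dart lies on the floor mid-edge at
abscissa `d`, i.e. `finalDart P = ((d, 0, false), (d, -1, true))` (an `α`-dart, pointing down) or
`finalDart P = ((d, -1, true), (d, 0, false))` (the reversed dart).  This file supplies the
registered stub `stub_codedArchSum_reflect` of the lead's reduction "window two-point lower bound
⟸ tail fraction ∧ drop": the coded floor-arch sum is the same at `d` and at `-d`.

Proof ("by vertical symmetry", §4.1 of GlazmanManolescu2019, as in `HV.triDl_eq_triDr`): the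
reflection `HV.reflT` of `ℍ` in the vertical axis of `a`, `(x₀, x₁, b) ↦ (-x₀ - x₁ - b, x₁, b)`, is
a graph automorphism fixing `w` and `O`; it preserves `V(S_{T,L})`
(`arcsWin_reflT_mem_stripV_iff` of the sibling file `…HexConjectureArcsInWindow.lean`), hence
transports mid-edge walks of the trapezoid (`IsMidWalk.map_iso`) preserving the length
(`mwLen_map`), and it maps the floor mid-edge at abscissa `c` onto the floor mid-edge at abscissa
`-c` dart by dart (`codedRefl_reflT_floor`, `codedRefl_reflT_below`, `finalDart_map_iso`).  Since
`reflT` is an involution, `P ↦ P.map reflT` is a weight-preserving bijection between the two coded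
classes (`Finset.sum_nbij'`).
-/

noncomputable section

open scoped BigOperators Classical
open Finset
open Literature.Probability.RandomPlanarGeometry Literature.Probability.RandomPlanarGeometry.SAW
  Literature.Probability.RandomPlanarGeometry.SAW.HV

namespace Summit.CriticalPhenomena.SAWScalingLimit.Theorems.HexConjecture.RootLocality

/-- The reflection sends the floor vertex `(c, 0, false)` to the floor vertex `(-c, 0, false)`.
[cite: GlazmanManolescu2019, §4.1 ("by vertical symmetry")] -/
theorem codedRefl_reflT_floor (c : ℤ) : reflT ((c, 0, false) : HV) = (-c, 0, false) := by
  refine Prod.ext ?_ rfl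
  show -c - 0 - bit ((c, 0, false) : HV) = -c
  rw [bit_false]; omega

/-- The reflection sends the vertex `(c, -1, true)` below the floor to `(-c, -1, true)`.
[cite: GlazmanManolescu2019, §4.1 ("by vertical symmetry")] -/
theorem codedRefl_reflT_below (c : ℤ) : reflT ((c, -1, true) : HV) = (-c, -1, true) := by
  refine Prod.ext ?_ rfl
  show -c - (-1) - bit ((c, -1, true) : HV) = -c
  rw [bit_true]; omega

/-- `reflT` is an involution on vertex lists: `(P.map reflT).map reflT = P`. [folklore] -/
theorem codedRefl_map_reflT_map_reflT (P : List HV) : (P.map reflT).map reflT = P := by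
  rw [List.map_map]
  conv_rhs => rw [← List.map_id P]
  refine List.map_congr_left fun v _ => ?_
  simp only [Function.comp_apply, id_eq]
  exact reflT_reflT v

/-- **The reflection transports the coded floor-arch class at abscissa `c` into the one at `-c`**:
if `P` is a self-avoiding mid-edge walk of a `reflT`-stable domain `V` ending on the floor
mid-edge at abscissa `c` (in either orientation), then `P.map reflT` is one ending on the floor
mid-edge at abscissa `-c` (in the same orientation).
[cite: GlazmanManolescu2019, §4.1 ("by vertical symmetry")] -/
theorem codedRefl_map_reflT_coded {V : Finset HV} (hV : ∀ x ∈ V, reflT x ∈ V) {c : ℤ}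
    {P : List HV} (hP : IsMidWalk V P)
    (hd : finalDart P = ((c, 0, false), (c, -1, true)) ∨
      finalDart P = ((c, -1, true), (c, 0, false))) :
    IsMidWalk V (P.map reflT) ∧
      (finalDart (P.map reflT) = ((-c, 0, false), (-c, -1, true)) ∨
        finalDart (P.map reflT) = ((-c, -1, true), (-c, 0, false))) := by
  refine ⟨hP.map_iso reflT reflT_wOut reflT_hvOrigin hV, ?_⟩
  rw [finalDart_map_iso reflT reflT_wOut]
  rcases hd with h | h <;> rw [h]
  · exact Or.inl (Prod.ext (codedRefl_reflT_floor c) (codedRefl_reflT_below c))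
  · exact Or.inr (Prod.ext (codedRefl_reflT_below c) (codedRefl_reflT_floor c))

/-- **The coded floor-arch sums of the trapezoid `S_{N+1,N+1}` are even in the offset** (registered
stub `stub_codedArchSum_reflect` of line `root-locality-replaces-loewner`): for every `N` and every
`d : ℤ`, the `x_c`-mass of the self-avoiding mid-edge walks of `S_{N+1,N+1}` from `a` ending on the
floor mid-edge at abscissa `-d` equals the one at abscissa `d` — the reflection `reflT` of the
half-plane in the vertical axis of the root is a weight-preserving bijection between the two
classes. [cite: GlazmanManolescu2019, §4.1 ("by vertical symmetry")] -/
theorem stub_codedArchSum_reflect : ∀ (N : ℕ) (d : ℤ), ∑ P ∈ (Literature.Probability.RandomPlanarGeometry.SAW.HV.midWalks (Literature.Probability.RandomPlanarGeometry.SAW.HV.stripV (N + 1) (N + 1))).filter (fun P => Literature.Probability.RandomPlanarGeometry.SAW.HV.finalDart P = ((-d, 0, false), (-d, -1, true)) ∨ Literature.Probability.RandomPlanarGeometry.SAW.HV.finalDart P = ((-d, -1, true), (-d, 0, false))), Literature.Probability.RandomPlanarGeometry.SAW.hexCriticalFugacity ^ Literature.Probability.RandomPlanarGeometry.SAW.HV.mwLen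 P = ∑ P ∈ (Literature.Probability.RandomPlanarGeometry.SAW.HV.midWalks (Literature.Probability.RandomPlanarGeometry.SAW.HV.stripV (N + 1) (N + 1))).filter (fun P => Literature.Probability.RandomPlanarGeometry.SAW.HV.finalDart P = ((d, 0, false), (d, -1, true)) ∨ Literature.Probability.RandomPlanarGeometry.SAW.HV.finalDart P = ((d, -1, true), (d, 0, false))), Literature.Probability.RandomPlanarGeometry.SAW.hexCriticalFugacity ^ Literature.Probability.RandomPlanarGeometry.SAW.HV.mwLen P := by
  intro N d
  have hV : ∀ x ∈ stripV (N + 1) (N + 1), reflT x ∈ stripV (N + 1) (N + 1) :=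
    fun x hx => (arcsWin_reflT_mem_stripV_iff x).2 hx
  refine Finset.sum_nbij' (fun P : List HV => P.map reflT) (fun P : List HV => P.map reflT)
    ?_ ?_ (fun P _ => codedRefl_map_reflT_map_reflT P) (fun P _ => codedRefl_map_reflT_map_reflT P)
    (fun P _ => by rw [mwLen_map])
  · intro P hP
    rw [mem_filter, mem_midWalks_iff] at hP ⊢
    have h := codedRefl_map_reflT_coded hV hP.1 hP.2
    rwa [neg_neg] at h
  · intro P hP
    rw [mem_filter, mem_midWalks_iff] at hP ⊢
    exact codedRefl_map_reflT_coded hV hP.1 hP.2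

end Summit.CriticalPhenomena.SAWScalingLimit.Theorems.HexConjecture.RootLocality

end
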